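import Literature.NumberTheory.Weil1964.DoublingDiagonalPolarisation
import HarnessLib

/-!
# The CAYLEY mover of the doubled polarisation: a symplectic `κ` with `κ W^Δ = 𝕐` AND `κ W^{Δ⁻} = 𝕏`, and the conjugate of the
# doubling's Weyl element `κ · m(1 ⊕ −1) · κ⁻¹ = J⁻¹ · m(j)`

[Kudla1994] S. S. Kudla, Israel J. Math. 87 (1994), §3 (the doubled space `𝕎 = W ⊕ W⁻`, its Lagrangians `W^Δ`, `W^{Δ⁻}` and the element
of `G(W) × G(W⁻)` swapping them); [Li1992] J.-S. Li, J. reine angew. Math. 428 (1992), p. 181 (the element `δ` of the doubling method);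
[MoeglinVignerasWaldspurger1987] Chap. 2 II.2 (Siegel Levi `m(a)`, Weyl element `J`).  Topic `NumberTheory/Weil1964`; namespace
`Literature.NumberTheory.Weil1964` (sibling of ★ `DoublingDiagonalPolarisation`, whose `δ = deltaDiagMatrix` carries `W^Δ` onto `𝕐` but NOT
`W^{Δ⁻}` onto `𝕏`, so that `δ · w_Δ · δ⁻¹` lies in the Siegel parabolic of `𝕏` instead of the big cell's one-sided form).  KERNEL linear algebra
over a commutative ring `K` with `2` invertible: definitions with bodies (`cayleyMoverMatrix`, `cayleyMover`, and the auxiliary `GL` elements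
`signGL`, `quarterTurnGL`) and proved lemmas; no named fact, no `sorry`.

In Darboux coordinates `(X₁, X₂; Y₁, Y₂)` of `𝕎 = W ⊕ W⁻` (Mathlib's `J = fromBlocks 0 (−1) 1 0`, `Matrix.symplecticGroup (ι ⊕ ι) K`; `𝕏 = {Y = 0}`,
`𝕐 = {X = 0}`, `W^Δ = {(a, a; b, −b)}`, `W^{Δ⁻} = {(a, −a; b, b)}`):
* §1 **`cayleyMoverMatrix`** `κ : (X₁, X₂; Y₁, Y₂) ↦ (X₁ − X₂, ½(Y₁ + Y₂); ½(Y₁ − Y₂), −(X₁ + X₂))`, symplectic (`cayleyMoverMatrix_mem`,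
  `cayleyMover : symplecticGroup (ι ⊕ ι) K`), fixed by ring maps (`cayleyMoverMatrix_map`, `mapHom_cayleyMover`).
* §2 `κ ((a, a); (c, −c)) = (0; (c, −2a))` (the diagonal `W^Δ` goes to `𝕐`, `cayleyMoverMatrix_mulVec_diag`) and
  `κ ((a, −a); (c, c)) = ((2a, c); 0)` (the antidiagonal `W^{Δ⁻}` goes to `𝕏`, `cayleyMoverMatrix_mulVec_antidiag`).
* §3 the sign element `ε = 1 ⊕ (−1)` (`signGL`; the matrix of the doubling's Weyl element `w_Δ = 1_W ⊕ (−1_{W⁻})` in Darboux coordinates is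
  the Levi element `m(ε) = ε ⊕ ε`), the quarter turn `j = [[0, −1], [1, 0]]` (`quarterTurnGL`, inverse `jᵀ`), and
  **`cayleyMover_mul_levi_signGL_mul_inv : κ · m(ε) · κ⁻¹ = J⁻¹ · m(j)`** — the conjugated Weyl element SWAPS `𝕏` and `𝕐`, in the one-sided
  shape `J⁻¹ · m(B)` consumed by the Weyl ∕ Fourier operator twin (★ `LocalSchrodingerWeylFourierTwin.implementer_apply_eq_smul_conj_fourierOpPi_leviOpPi`),
  read on matrices as `J · κ · m(ε) = m(j) · κ` (`J_mul_cayleyMoverMatrix_mul_levi_signGL`).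

Cell hodgecm-mathlib, line LD2, plate (GRP-W) «WEYL GROUP SHAPE» of LD2-plan (g3) DEALS #15 (2), FILE M1 (the ring-generic matrix algebra; the
transport to `Sp(𝕎^𝔻_v)` and the identification of `ι_D(w_Δ)` with `m(ε)` are the sequel); `--supports stmt-HodgeConjecture-24832`.  HONEST LABEL:
HC_CM is proved only modulo the 7 printed citations (2 remaining: hLiu418 = stmt-HodgeConjecture-24832, h413 = stmt-HodgeConjecture-24833) until rung 0
closes; count-neutral.

## References
* [Kudla1994] S. S. Kudla, *Splitting metaplectic covers of dual reductive pairs*, Israel J. Math. 87 (1994) 361–401, §3.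
* [Li1992] J.-S. Li, *Non-vanishing theorems for the cohomology of certain arithmetic quotients*, J. reine angew. Math. 428 (1992), p. 181.
* [MoeglinVignerasWaldspurger1987] C. Mœglin, M.-F. Vignéras, J.-L. Waldspurger, LNM 1291 (1987), Chap. 2 II.2.
-/

set_option autoImplicit false

noncomputable section

open scoped Matrix

namespace Literature.NumberTheory.Weil1964

open Literature.RepresentationTheory.HeisenbergGroup Literature.RepresentationTheory.HeisenbergGroup.SymplecticMatrix

section Generic

variable (K : Type*) [CommRing K] (ι : Type*) [Fintype ι] [DecidableEq ι]

/-! ## §0 The sign element `ε` and the quarter turn `j` of `GL(ι ⊕ ι)` -/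

/-- **the sign element `ε = 1 ⊕ (−1) ∈ GL(ι ⊕ ι)`** (so that `m(ε) = diag(1, −1, 1, −1)` is the doubling's Weyl element `1_W ⊕ (−1_{W⁻})` in
Darboux coordinates); `ε⁻¹ = ε`. [cite: Kudla1994, §3] -/
def signGL : GL (ι ⊕ ι) K where
  val := Matrix.fromBlocks 1 0 0 (-1)
  inv := Matrix.fromBlocks 1 0 0 (-1)
  val_inv := by simp [Matrix.fromBlocks_multiply, Matrix.fromBlocks_one]
  inv_val := by simp [Matrix.fromBlocks_multiply, Matrix.fromBlocks_one]

/-- the matrix of `ε`. [cite: Kudla1994, §3] -/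
@[simp] theorem coe_signGL : ((signGL K ι : GL (ι ⊕ ι) K) : Matrix (ι ⊕ ι) (ι ⊕ ι) K) = Matrix.fromBlocks 1 0 0 (-1) := rfl

/-- the matrix of `ε⁻¹ = ε`. [cite: Kudla1994, §3] -/
@[simp] theorem coe_signGL_inv : (((signGL K ι)⁻¹ : GL (ι ⊕ ι) K) : Matrix (ι ⊕ ι) (ι ⊕ ι) K) = Matrix.fromBlocks 1 0 0 (-1) := rfl

/-- **the quarter turn `j = [[0, −1], [1, 0]] ∈ GL(ι ⊕ ι)`**, with inverse `jᵀ = [[0, 1], [−1, 0]]`. [cite: MoeglinVignerasWaldspurger1987, Chap. 2 II.2] -/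
def quarterTurnGL : GL (ι ⊕ ι) K where
  val := Matrix.fromBlocks 0 (-1) 1 0
  inv := Matrix.fromBlocks 0 1 (-1) 0
  val_inv := by simp [Matrix.fromBlocks_multiply, Matrix.fromBlocks_one]
  inv_val := by simp [Matrix.fromBlocks_multiply, Matrix.fromBlocks_one]

/-- the matrix of `j`. [cite: MoeglinVignerasWaldspurger1987, Chap. 2 II.2] -/
@[simp] theorem coe_quarterTurnGL :
    ((quarterTurnGL K ι : GL (ι ⊕ ι) K) : Matrix (ι ⊕ ι) (ι ⊕ ι) K) = Matrix.fromBlocks 0 (-1) 1 0 := rfl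

/-- the matrix of `j⁻¹ = jᵀ`. [cite: MoeglinVignerasWaldspurger1987, Chap. 2 II.2] -/
@[simp] theorem coe_quarterTurnGL_inv :
    (((quarterTurnGL K ι)⁻¹ : GL (ι ⊕ ι) K) : Matrix (ι ⊕ ι) (ι ⊕ ι) K) = Matrix.fromBlocks 0 1 (-1) 0 := rfl

variable [Invertible (2 : K)]

/-! ## §1 The Cayley mover `κ` -/

/-- **the Cayley mover `κ`**: `(X₁, X₂; Y₁, Y₂) ↦ (X₁ − X₂, ½(Y₁ + Y₂); ½(Y₁ − Y₂), −(X₁ + X₂))` on `K^{(ι⊕ι)⊕(ι⊕ι)}` (Darboux coordinates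
`(X; Y)` of `𝕎 = W ⊕ W⁻`). [cite: Kudla1994, §3] -/
def cayleyMoverMatrix : Matrix ((ι ⊕ ι) ⊕ (ι ⊕ ι)) ((ι ⊕ ι) ⊕ (ι ⊕ ι)) K :=
  Matrix.fromBlocks (Matrix.fromBlocks 1 (-1) 0 0) (Matrix.fromBlocks 0 0 ((⅟(2 : K)) • (1 : Matrix ι ι K)) ((⅟(2 : K)) • (1 : Matrix ι ι K)))
    (Matrix.fromBlocks 0 0 (-1) (-1)) (Matrix.fromBlocks ((⅟(2 : K)) • (1 : Matrix ι ι K)) (-((⅟(2 : K)) • (1 : Matrix ι ι K))) 0 0)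

/-- `κ` is symplectic (`κᵀ J κ = J`, Mathlib's block criterion). [cite: Kudla1994, §3] -/
theorem cayleyMoverMatrix_mem : cayleyMoverMatrix K ι ∈ Matrix.symplecticGroup (ι ⊕ ι) K := by
  rw [cayleyMoverMatrix, SymplecticGroup.fromBlocks_mem_iff]
  have h2 : (⅟(2 : K)) • (1 : Matrix ι ι K) + (⅟(2 : K)) • (1 : Matrix ι ι K) = 1 := by
    rw [← add_smul, ← two_mul, mul_invOf_self, one_smul]
  refine ⟨?_, ?_, ?_⟩
  · simp [Matrix.fromBlocks_transpose, Matrix.fromBlocks_multiply]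
  · simp [Matrix.fromBlocks_transpose, Matrix.fromBlocks_multiply]
  · simp only [Matrix.fromBlocks_transpose, Matrix.fromBlocks_multiply, Matrix.transpose_one, Matrix.transpose_zero,
      Matrix.transpose_neg, Matrix.mul_one, Matrix.mul_zero, Matrix.mul_neg, add_zero, zero_add, Matrix.mul_smul,
      sub_eq_add_neg, Matrix.fromBlocks_neg, Matrix.fromBlocks_add, smul_neg, neg_neg, neg_add_cancel, h2, Matrix.fromBlocks_one]

/-- **`κ ∈ Sp_{2(ι⊕ι)}(K)`** as an element of Mathlib's symplectic group. [cite: Kudla1994, §3] -/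
def cayleyMover : Matrix.symplecticGroup (ι ⊕ ι) K := ⟨cayleyMoverMatrix K ι, cayleyMoverMatrix_mem K ι⟩

/-- its matrix. [cite: Kudla1994, §3] -/
@[simp] theorem coe_cayleyMover :
    ((cayleyMover K ι : Matrix.symplecticGroup (ι ⊕ ι) K) : Matrix ((ι ⊕ ι) ⊕ (ι ⊕ ι)) ((ι ⊕ ι) ⊕ (ι ⊕ ι)) K) =
      cayleyMoverMatrix K ι :=
  rfl

variable {K} in
omit [Fintype ι] [DecidableEq ι] in
/-- a ring map into a ring with `2` invertible sends `⅟2` to `⅟2`. [cite: Kudla1994, §3] -/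
theorem ringHom_invOf_two {K' : Type*} [CommRing K'] [Invertible (2 : K')] (f : K →+* K') : f (⅟(2 : K)) = ⅟(2 : K') := by
  symm
  apply invOf_eq_right_inv
  rw [← map_ofNat f 2, ← map_mul, mul_invOf_self, map_one]

variable {K ι} in
omit [Fintype ι] in
/-- `κ` is defined over `ℤ[½]`: entrywise ring maps fix it. [cite: Kudla1994, §3] -/
theorem cayleyMoverMatrix_map {K' : Type*} [CommRing K'] [Invertible (2 : K')] (f : K →+* K') :
    (cayleyMoverMatrix K ι).map f = cayleyMoverMatrix K' ι := by
  have hs : ((⅟(2 : K)) • (1 : Matrix ι ι K)).map f = (⅟(2 : K')) • (1 : Matrix ι ι K') := by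
    rw [Matrix.map_smul' _ _ _ (map_mul f), Matrix.map_one f (map_zero f) (map_one f), ringHom_invOf_two f]
  simp only [cayleyMoverMatrix, Matrix.fromBlocks_map, Matrix.map_zero _ (map_zero f), Matrix.map_neg _ (map_neg f),
    Matrix.map_one f (map_zero f) (map_one f), hs]

variable {K ι} in
/-- `mapHom f κ = κ`. [cite: Kudla1994, §3] -/
theorem mapHom_cayleyMover {K' : Type*} [CommRing K'] [Invertible (2 : K')] (f : K →+* K') :
    mapHom f (cayleyMover K ι) = cayleyMover K' ι :=
  Subtype.ext (by rw [coe_mapHom, coe_cayleyMover, coe_cayleyMover, cayleyMoverMatrix_map])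

/-! ## §2 `κ` carries the diagonal `W^Δ` onto `𝕐` and the antidiagonal `W^{Δ⁻}` onto `𝕏` -/

variable {K ι}

/-- the action of `κ` in Darboux coordinates on a diagonal point: `κ ((a, a); (c, −c)) = (0; (c, −2a))` — `κ W^Δ ⊆ 𝕐`. [cite: Kudla1994, §3] -/
theorem cayleyMoverMatrix_mulVec_diag (a c : ι → K) :
    cayleyMoverMatrix K ι *ᵥ Sum.elim (Sum.elim a a) (Sum.elim c (-c)) =
      Sum.elim (0 : ι ⊕ ι → K) (Sum.elim c (-((2 : K) • a))) := by
  have hh : ∀ x : ι → K, (⅟(2 : K)) • x + (⅟(2 : K)) • x = x := fun x => by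
    rw [← add_smul, ← two_mul, mul_invOf_self, one_smul]
  simp only [cayleyMoverMatrix, Matrix.fromBlocks_mulVec, Sum.elim_comp_inl, Sum.elim_comp_inr, Matrix.one_mulVec,
    Matrix.neg_mulVec, Matrix.zero_mulVec, Matrix.smul_mulVec, add_zero, smul_neg, add_neg_cancel, neg_neg, hh, two_smul,
    neg_add]
  funext i
  rcases i with (i | i) | (i | i) <;> simp only [Sum.elim_inl, Sum.elim_inr, Pi.add_apply, Pi.zero_apply, add_zero, zero_add]

/-- the action of `κ` on an antidiagonal point: `κ ((a, −a); (c, c)) = ((2a, c); 0)` — `κ W^{Δ⁻} ⊆ 𝕏`. [cite: Kudla1994, §3] -/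
theorem cayleyMoverMatrix_mulVec_antidiag (a c : ι → K) :
    cayleyMoverMatrix K ι *ᵥ Sum.elim (Sum.elim a (-a)) (Sum.elim c c) =
      Sum.elim (Sum.elim ((2 : K) • a) c) (0 : ι ⊕ ι → K) := by
  have hh : ∀ x : ι → K, (⅟(2 : K)) • x + (⅟(2 : K)) • x = x := fun x => by
    rw [← add_smul, ← two_mul, mul_invOf_self, one_smul]
  simp only [cayleyMoverMatrix, Matrix.fromBlocks_mulVec, Sum.elim_comp_inl, Sum.elim_comp_inr, Matrix.one_mulVec,
    Matrix.neg_mulVec, Matrix.zero_mulVec, Matrix.smul_mulVec, add_zero, add_neg_cancel, neg_neg, hh, two_smul,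
    neg_add_cancel]
  funext i
  rcases i with (i | i) | (i | i) <;> simp only [Sum.elim_inl, Sum.elim_inr, Pi.add_apply, Pi.zero_apply, add_zero, zero_add]

/-! ## §3 The conjugate of the Weyl element: `κ · m(ε) · κ⁻¹ = J⁻¹ · m(j)` -/

variable (K ι)

/-- the matrix identity behind the conjugation: `J · κ · m(ε) = m(j) · κ`. [cite: Kudla1994, §3] -/
theorem J_mul_cayleyMoverMatrix_mul_levi_signGL :
    Matrix.J (ι ⊕ ι) K * cayleyMoverMatrix K ι * ((levi (signGL K ι) : Matrix.symplecticGroup (ι ⊕ ι) K) : Matrix _ _ K) =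
      ((levi (quarterTurnGL K ι) : Matrix.symplecticGroup (ι ⊕ ι) K) : Matrix _ _ K) * cayleyMoverMatrix K ι := by
  simp only [Matrix.J, cayleyMoverMatrix, coe_levi, coe_signGL, coe_signGL_inv, coe_quarterTurnGL, coe_quarterTurnGL_inv,
    Matrix.fromBlocks_transpose, Matrix.transpose_one, Matrix.transpose_zero, Matrix.transpose_neg, Matrix.fromBlocks_multiply,
    Matrix.mul_one, Matrix.one_mul, Matrix.mul_zero, Matrix.zero_mul, Matrix.mul_neg, Matrix.neg_mul, Matrix.mul_smul,
    Matrix.fromBlocks_neg, neg_neg, neg_zero, smul_zero, add_zero, zero_add, smul_neg]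

/-- the same identity on bare matrices (both `ε` and `j` coincide with their inverse transposes): `J · κ · (ε ⊕ ε) = (j ⊕ j) · κ` — the form
that transports along re-indexings and ring maps. [cite: Kudla1994, §3] -/
theorem J_mul_cayleyMoverMatrix_mul_fromBlocks_sign :
    Matrix.J (ι ⊕ ι) K * cayleyMoverMatrix K ι *
        Matrix.fromBlocks (Matrix.fromBlocks 1 0 0 (-1)) 0 0 (Matrix.fromBlocks 1 0 0 (-1) : Matrix (ι ⊕ ι) (ι ⊕ ι) K) =
      Matrix.fromBlocks (Matrix.fromBlocks 0 (-1) 1 0) 0 0 (Matrix.fromBlocks 0 (-1) 1 0 : Matrix (ι ⊕ ι) (ι ⊕ ι) K) *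
        cayleyMoverMatrix K ι := by
  have h := J_mul_cayleyMoverMatrix_mul_levi_signGL K ι
  simp only [coe_levi, coe_signGL, coe_signGL_inv, coe_quarterTurnGL, coe_quarterTurnGL_inv, Matrix.fromBlocks_transpose,
    Matrix.transpose_one, Matrix.transpose_zero, Matrix.transpose_neg] at h
  exact h

/-- **THE CONJUGATED WEYL ELEMENT**: `κ · m(ε) · κ⁻¹ = J⁻¹ · m(j)` in `Sp_{2(ι⊕ι)}(K)` — after the Cayley mover the doubling's Weyl element
`w_Δ = m(ε)` becomes the Weyl element `J⁻¹` followed by the Levi quarter turn `m(j)`. [cite: Kudla1994, §3] -/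
theorem cayleyMover_mul_levi_signGL_mul_inv :
    cayleyMover K ι * levi (signGL K ι) * (cayleyMover K ι)⁻¹ =
      (SymplecticGroup.symJ (ι ⊕ ι) K)⁻¹ * levi (quarterTurnGL K ι) := by
  rw [mul_inv_eq_iff_eq_mul, mul_assoc, eq_inv_mul_iff_mul_eq]
  apply Subtype.ext
  rw [Submonoid.coe_mul, Submonoid.coe_mul, Submonoid.coe_mul, SymplecticGroup.coe_J, coe_cayleyMover, ← Matrix.mul_assoc]
  exact J_mul_cayleyMoverMatrix_mul_levi_signGL K ι

end Generic

end Literature.NumberTheory.Weil1964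

end
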